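import Literature.NumberTheory.Congruences.DworkCongruences
import HarnessLib

/-!
# Dwork congruences for constant terms — ghost terms and the proof of Samol–van Straten's Theorem 6

Topic `Literature/NumberTheory/Congruences`, namespace `Literature.NumberTheory.Congruences.DworkCongruences`
(continued from `DworkCongruences.lean`, which holds the vocabulary, the two NAMED FACTS and the elementary
step "first-block recursion ⇒ (D3)"). Source followed here, read on the page: A. Mellit, M. Vlasenko,
*Dwork's congruences for the constant terms of powers of a Laurent polynomial*, Int. J. Number Theory **12**
(2016) 313–321 = arXiv:1306.5811, §§2–4 [MellitVlasenko2016]. Everything in this file is PROVED (no named fact);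
the end product is **`samolVanStraten2015_theorem6_holds`** (discharging [SamolVanstraten2015, Thm. 6]) and
its ring-general form `dwork_congruence` (any commutative coefficient ring `R` with `p ∣ a^p − a` for all `a`,
e.g. `ℤ` and `ℤ_p` — `dwork_congruence_padicInt`).

## The printed argument (§§2–4) and how it is formalised

* **§2 Ghost terms.** `Λ(x^m) := Λ(x_1^m, …, x_d^m)` (`frob m`, the ring endomorphism of `R[ℤ^d]` induced by
  `𝐮 ↦ m𝐮`); `R_s(Λ) := Λ(x)^{p^s} − Λ(x^p)^{p^{s−1}}`, `R_0(Λ) := Λ` (`ghost p s Λ`). Proposition 1: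
  (i) `Λ^{p^s} = R_0(Λ)(x^{p^s}) + R_1(Λ)(x^{p^{s−1}}) + ⋯ + R_s(Λ)(x)` (`pow_prime_pow_eq_sum_ghost`);
  (ii) `R_s(Λ) ≡ 0 mod p^s` (`ghost_dvd`, from `p ∣ Λ^p − Λ(x^p)` — `frobenius_dvd` — and "if `X ≡ Y mod p^s`
  then `X^p ≡ Y^p mod p^{s+1}`", Mathlib's `dvd_sub_pow_of_dvd_sub`); (iii) `Newt(R_s(Λ)) ⊂ p^s Newt(Λ)`
  (support bookkeeping `SuppIn`, `suppIn_ghost`). Writing `n = n_0 + n_1 p + ⋯ + n_{ℓ−1} p^{ℓ−1}`,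
  `Λ^n = Π_i (Λ^{n_i})^{p^i}` is the sum over tuples `m = (m_0, …, m_{ℓ−1})`, `0 ≤ m_i ≤ i`, of
  `R^n_{m,Λ} = Π_i R_{m_i}(Λ^{n_i})(x^{p^{i − m_i}})` (`bigPow_eq_sum_gterm`; we index by the "reach"
  `t_i := i − m_i ∈ [0, i]`, `tuples L`, `gterm`).
* **§3 Indecomposable tuples.** `m = m' * m''` (concatenation); we say `j` is a CUT of `t` when `t_i ≥ j` for all
  `i ≥ j` (`IsCut`), so "indecomposable" = "no cut `1 ≤ j < ℓ`", and we group tuples by their FIRST cut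
  (`FirstCut`, `cutSum`; `I_Λ^n` = the no-cut part `Ipoly`). Proposition 2 ("`m` indecomposable ⇒ `|m| ≥ k − 1`",
  the covering argument "for each `i ∈ {1, …, k−1}` there exists `j ≥ i` with `m_j > j − i`") is
  `sub_one_le_weight_of_firstCut`; Proposition 3 (i) (the expansion of `Λ^n` over partitions into indecomposable
  blocks) is formalised in first-cut form: `Π_{i<L} Φ_i^{p^i} = Σ_{j=1}^{L} I(Φ_0..Φ_{j−1}) · (Π_{i<L−j} Φ_{j+i}^{p^i})(x^{p^j})`
  (`bigPow_decomp`, via the snoc-recurrence `cutSum_succ` and `cutSum_eq`); (ii) `I ≡ 0 mod p^{ℓ−1}`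
  (`Ipoly_dvd`); (iii) `Newt(I^n) ⊂ n Newt(Λ)` (`suppIn_Ipoly`).
* **§4 One interior point.** Proposition 4: if `0` is the only interior lattice point of `Newt(Λ)`,
  `Newt(Φ) ⊂ n Newt(Λ)` and `n < q`, then `[Φ(x) Ψ(x^q)]_0 = [Φ]_0 [Ψ]_0` ("`n Newt(Λ)` contains no point of the
  lattice `q ℤ^d` other than `0`") — `constTerm_mul_frob`. Corollary / Lemma 1 in first-block form:
  `b_n = Σ_{j=1}^{ℓ(n)} [block admissible] c_{n mod p^j} b_{⌊n/p^j⌋}` with `c_k = [I_Λ^k]_0 ≡ 0 mod p^{ℓ(k)−1}`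
  (`ctPow_blockRecursion`, `cseq_dvd`), whence (D3) by `dwork_congruence_of_blockRecursion` of the sibling file.

Design notes. (1) Coefficients: any commutative ring `R` with the Fermat property `∀ a, p ∣ a^p − a` (this is all
§2 (ii) uses); `ℤ` (`samolVanStraten2015_theorem6_holds`) and `ℤ_p` (`dwork_congruence_padicInt`) are instances.
(2) The interior hypothesis is used exactly once, in the form "`0 ∈ interior`, `w ∈ Newt`, `0 ≤ t < 1` ⇒
`t w ∈ interior`" (Mathlib `Convex.combo_interior_self_mem_interior`). (3) Nothing here is specific to
constant terms of powers beyond Lemma 1: the sibling file's `dwork_congruence_of_blockRecursion` is the reusable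
statement for other sequences admitting a first-block recursion.
-/

noncomputable section

open Finset Pointwise

namespace Literature.NumberTheory.Congruences.DworkCongruences

variable {R : Type*} [CommRing R] {d : ℕ}

/-! ## §2. The substitutions `x ↦ x^m` and the ghost terms -/

/-- Scaling of exponent vectors `𝐮 ↦ m 𝐮`. [cite: MellitVlasenko2016, §2 (notation `Λ(x^m)`)] -/
def scaleExp (d m : ℕ) : (Fin d → ℤ) →+ (Fin d → ℤ) where
  toFun u := m • u
  map_zero' := smul_zero _
  map_add' _ _ := smul_add _ _ _

/-- `Λ(x^m) := Λ(x_1^m, …, x_d^m)`, the ring endomorphism of `R[x_1^{±1}, …, x_d^{±1}]` induced by `𝐮 ↦ m𝐮`.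
[cite: MellitVlasenko2016, §2 (notation `Λ(x^m)`)] -/
def frob (m : ℕ) : LaurentPoly R d →+* LaurentPoly R d :=
  AddMonoidAlgebra.mapDomainRingHom R (scaleExp d m)

/-- Coefficients of `Λ(x^m)`: push-forward of those of `Λ` along `𝐮 ↦ m𝐮`. [cite: MellitVlasenko2016, §2
(notation `Λ(x^m)`)] -/
theorem coeff_frob (m : ℕ) (Φ : LaurentPoly R d) :
    (frob m Φ).coeff = Finsupp.mapDomain (fun u : Fin d → ℤ => m • u) Φ.coeff := rfl

/-- `(x^𝐮)(x^m) = x^{m𝐮}`. [cite: MellitVlasenko2016, §2 (notation `Λ(x^m)`)] -/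
theorem frob_single (m : ℕ) (u : Fin d → ℤ) (r : R) :
    frob m (AddMonoidAlgebra.single u r : LaurentPoly R d) = AddMonoidAlgebra.single (m • u) r := by
  change AddMonoidAlgebra.mapDomain _ _ = _
  rw [AddMonoidAlgebra.mapDomain_single]
  rfl

/-- `Λ(x^1) = Λ`. [cite: MellitVlasenko2016, §2 (notation `Λ(x^m)`)] -/
theorem frob_one_eq (Φ : LaurentPoly R d) : frob 1 Φ = Φ := by
  induction Φ using AddMonoidAlgebra.induction_linear with
  | zero => simp
  | add x y hx hy => rw [map_add, hx, hy]
  | single u r => rw [frob_single, one_smul]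

/-- `(Λ(x^b))(x^a) = Λ(x^{ab})`. [cite: MellitVlasenko2016, §2 (notation `Λ(x^m)`)] -/
theorem frob_frob (a b : ℕ) (Φ : LaurentPoly R d) : frob a (frob b Φ) = frob (a * b) Φ := by
  induction Φ using AddMonoidAlgebra.induction_linear with
  | zero => simp
  | add x y hx hy => simp only [map_add, hx, hy]
  | single u r => rw [frob_single, frob_single, frob_single, mul_smul]

/-- The coefficient of `x^{m𝐮}` in `Λ(x^m)` is the coefficient of `x^𝐮` in `Λ` (`m ≠ 0`).
[cite: MellitVlasenko2016, §2 (notation `Λ(x^m)`)] -/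
theorem coeff_frob_smul {m : ℕ} (hm : m ≠ 0) (Φ : LaurentPoly R d) (u : Fin d → ℤ) :
    (frob m Φ).coeff (m • u) = Φ.coeff u := by
  rw [coeff_frob]
  exact Finsupp.mapDomain_apply (smul_right_injective (Fin d → ℤ) hm) _ _

/-- In particular `[Λ(x^m)]_0 = [Λ]_0`. [cite: MellitVlasenko2016, §2 (notation `Λ(x^m)`)] -/
theorem constTerm_frob {m : ℕ} (hm : m ≠ 0) (Φ : LaurentPoly R d) : constTerm (frob m Φ) = constTerm Φ := by
  have := coeff_frob_smul hm Φ 0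
  rwa [smul_zero] at this

/-- The support of `Λ(x^m)` is `m · supp(Λ)`. [cite: MellitVlasenko2016, §2 (Newton polyhedra of `Φ(x^m)`)] -/
theorem mem_support_frob {m : ℕ} {Φ : LaurentPoly R d} {v : Fin d → ℤ} (hv : v ∈ (frob m Φ).coeff.support) :
    ∃ u ∈ Φ.coeff.support, v = m • u := by
  classical
  rw [coeff_frob] at hv
  have := Finsupp.mapDomain_support hv
  simp only [Finset.mem_image] at this
  obtain ⟨u, hu, rfl⟩ := this
  exact ⟨u, hu, rfl⟩

/-- **Frobenius modulo `p`:** `p ∣ Λ(x)^p − Λ(x^p)` in `R[x^{±1}]`, for a coefficient ring with `p ∣ a^p − a`.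
[cite: MellitVlasenko2016, Prop. 1 (ii) (proof: "clearly `p | Λ(x)^p − Λ(x^p)`")] -/
theorem frobenius_dvd {p : ℕ} (hp : p.Prime) (hR : ∀ a : R, (p : R) ∣ a ^ p - a) (Φ : LaurentPoly R d) :
    (p : LaurentPoly R d) ∣ Φ ^ p - frob p Φ := by
  induction Φ using AddMonoidAlgebra.induction_linear with
  | zero => simp [zero_pow hp.ne_zero]
  | add x y hx hy =>
    obtain ⟨r, hr⟩ := exists_add_pow_prime_eq hp x y
    rw [hr, map_add, show x ^ p + y ^ p + (p : LaurentPoly R d) * x * y * r - (frob p x + frob p y) =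
      (x ^ p - frob p x) + (y ^ p - frob p y) + (p : LaurentPoly R d) * (x * y * r) by ring]
    exact dvd_add (dvd_add hx hy) (dvd_mul_right _ _)
  | single u a =>
    obtain ⟨r, hr⟩ := hR a
    rw [AddMonoidAlgebra.single_pow, frob_single, ← AddMonoidAlgebra.single_sub, hr,
      AddMonoidAlgebra.natCast_def]
    exact ⟨AddMonoidAlgebra.single (p • u) r, by rw [AddMonoidAlgebra.single_mul_single, zero_add]⟩

/-- The ghost terms `R_s(Λ) := Λ(x)^{p^s} − Λ(x^p)^{p^{s−1}}` (`s ≥ 1`), `R_0(Λ) := Λ`.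
[cite: MellitVlasenko2016, §2 Definition (ghost term)] -/
def ghost (p : ℕ) : ℕ → LaurentPoly R d → LaurentPoly R d
  | 0, Φ => Φ
  | s + 1, Φ => Φ ^ p ^ (s + 1) - frob p (Φ ^ p ^ s)

/-- `R_0(Λ) = Λ`. [cite: MellitVlasenko2016, §2 Definition (ghost term)] -/
@[simp] theorem ghost_zero (p : ℕ) (Φ : LaurentPoly R d) : ghost p 0 Φ = Φ := rfl

/-- `R_{s+1}(Λ) = Λ^{p^{s+1}} − Λ(x^p)^{p^s}`. [cite: MellitVlasenko2016, §2 Definition (ghost term)] -/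
theorem ghost_succ (p s : ℕ) (Φ : LaurentPoly R d) :
    ghost p (s + 1) Φ = Φ ^ p ^ (s + 1) - frob p (Φ ^ p ^ s) := rfl

/-- `R_s(1) = 0` for `s ≥ 1` ("the product … contains `R_s(Λ^0) = R_s(1) = 0` for `s > 0`").
[cite: MellitVlasenko2016, Prop. 3 (proof)] -/
theorem ghost_succ_one (p s : ℕ) : ghost p (s + 1) (1 : LaurentPoly R d) = 0 := by
  rw [ghost_succ, one_pow, one_pow, map_one, sub_self]

/-- Ghost terms commute with the substitutions `x ↦ x^m`. [cite: MellitVlasenko2016, §2 (ghost terms of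
`Λ(x^p)`)] -/
theorem ghost_frob (p m s : ℕ) (Φ : LaurentPoly R d) : ghost p s (frob m Φ) = frob m (ghost p s Φ) := by
  cases s with
  | zero => rfl
  | succ s => rw [ghost_succ, ghost_succ, map_sub, ← map_pow, ← map_pow, frob_frob, frob_frob, mul_comm]

/-- **Proposition 1 (i):** `Λ^{p^s} = Σ_{t=0}^{s} R_{s−t}(Λ)(x^{p^t})`.
[cite: MellitVlasenko2016, Prop. 1 (i)] -/
theorem pow_prime_pow_eq_sum_ghost (p : ℕ) (Φ : LaurentPoly R d) (s : ℕ) :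
    Φ ^ p ^ s = ∑ t ∈ range (s + 1), frob (p ^ t) (ghost p (s - t) Φ) := by
  induction s with
  | zero => simp [frob_one_eq]
  | succ s ih =>
    rw [Finset.sum_range_succ', pow_zero, frob_one_eq, Nat.sub_zero, ghost_succ]
    have : ∑ t ∈ range (s + 1), frob (p ^ (t + 1)) (ghost p (s + 1 - (t + 1)) Φ) =
        frob p (Φ ^ p ^ s) := by
      rw [ih, map_sum]
      refine Finset.sum_congr rfl fun t ht => ?_
      rw [Nat.add_sub_add_right, pow_succ', ← frob_frob]
    rw [this]; abel

/-- **Proposition 1 (ii):** `R_s(Λ) ≡ 0 mod p^s`. [cite: MellitVlasenko2016, Prop. 1 (ii)] -/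
theorem ghost_dvd {p : ℕ} (hp : p.Prime) (hR : ∀ a : R, (p : R) ∣ a ^ p - a) (s : ℕ) (Φ : LaurentPoly R d) :
    (p : LaurentPoly R d) ^ s ∣ ghost p s Φ := by
  cases s with
  | zero => simp
  | succ s =>
    have h := dvd_sub_pow_of_dvd_sub (frobenius_dvd hp hR Φ) s
    rwa [← pow_mul, ← pow_succ', ← map_pow, ← ghost_succ] at h

/-! ## §2–§3. The expansion over tuples and the first-cut decomposition -/

/-- The tuples `t = (t_0, …, t_{L−1})` with `0 ≤ t_i ≤ i` (we record the reach `t_i = i − m_i` of the source's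
`m ∈ S_L`). [cite: MellitVlasenko2016, §3 (the sets `S_k`)] -/
def tuples (L : ℕ) : Finset (Fin L → ℕ) := Fintype.piFinset fun i : Fin L => range (i.val + 1)

/-- `t ∈ tuples L ↔ 0 ≤ t_i ≤ i` for all `i`. [cite: MellitVlasenko2016, §3 (the sets `S_k`)] -/
theorem mem_tuples {L : ℕ} {t : Fin L → ℕ} : t ∈ tuples L ↔ ∀ i, t i ≤ i.val := by
  simp [tuples, Fintype.mem_piFinset]

/-- The product of ghost terms `R^n_{m,Λ} = Π_i R_{m_i}(Φ_i)(x^{p^{i−m_i}})` attached to a tuple (here with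
`t_i = i − m_i` and general factors `Φ_i` in place of `Λ^{n_i}`). [cite: MellitVlasenko2016, §2 (`R^n_{m,Λ}`)] -/
def gterm (p : ℕ) (Φ : ℕ → LaurentPoly R d) (L : ℕ) (t : Fin L → ℕ) : LaurentPoly R d :=
  ∏ i : Fin L, frob (p ^ t i) (ghost p (i.val - t i) (Φ i))

/-- `Π_{i<L} Φ_i^{p^i}` (for `Φ_i = Λ^{n_i}` this is `Λ^n`, `n = Σ n_i p^i`).
[cite: MellitVlasenko2016, §2 (`Λ^n = Λ^{n_0}(Λ^{n_1})^p ⋯`)] -/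
def bigPow (p : ℕ) (Φ : ℕ → LaurentPoly R d) (L : ℕ) : LaurentPoly R d := ∏ i : Fin L, Φ i ^ p ^ i.val

/-- `Π_i Φ_i^{p^i} = Σ_{m ∈ S_L} R^n_{m}` ("we obtain that `Λ(x)^n` is the sum of the products `R^n_{m,Λ}`").
[cite: MellitVlasenko2016, §2 (last display)] -/
theorem bigPow_eq_sum_gterm (p : ℕ) (Φ : ℕ → LaurentPoly R d) (L : ℕ) :
    bigPow p Φ L = ∑ t ∈ tuples L, gterm p Φ L t := by
  unfold bigPow gterm tuples
  calc ∏ i : Fin L, Φ i ^ p ^ i.val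
      = ∏ i : Fin L, ∑ j ∈ range (i.val + 1), frob (p ^ j) (ghost p (i.val - j) (Φ i)) :=
        Finset.prod_congr rfl fun i _ => pow_prime_pow_eq_sum_ghost p (Φ i) i.val
    _ = _ := Finset.prod_univ_sum (fun i : Fin L => range (i.val + 1))
        (fun i j => frob (p ^ j) (ghost p (i.val - j) (Φ i)))

/-- `j` is a CUT of the tuple `t`: every position `i ≥ j` has reach `t_i ≥ j` (so that `t` is the concatenation of
its restrictions to `[0, j)` and `[j, L)`; "indecomposable" = no cut `1 ≤ j < L`).
[cite: MellitVlasenko2016, §3 Definition (indecomposable tuples)] -/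
abbrev IsCut (L : ℕ) (t : Fin L → ℕ) (j : ℕ) : Prop := ∀ i : Fin L, j ≤ i.val → j ≤ t i

/-- `j` is the FIRST cut of `t` (`j ≥ 1`; every `j ≥ L` is a cut, so the first cut is `≤ L` when `L ≥ 1`, and it
equals `L` exactly when `t` is indecomposable). [cite: MellitVlasenko2016, §3 (unique factorisation into
indecomposable tuples)] -/
abbrev FirstCut (L : ℕ) (t : Fin L → ℕ) (j : ℕ) : Prop :=
  1 ≤ j ∧ IsCut L t j ∧ ∀ j' < j, 1 ≤ j' → ¬ IsCut L t j'

/-- The sum of the `R_m` over the tuples with first cut `j`. [cite: MellitVlasenko2016, Prop. 3 (i)] -/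
def cutSum (p : ℕ) (Φ : ℕ → LaurentPoly R d) (L j : ℕ) : LaurentPoly R d :=
  ∑ t ∈ (tuples L).filter (fun t => FirstCut L t j), gterm p Φ L t

/-- `I(Φ_0, …, Φ_{L−1}) := Σ_{m indecomposable} R_m` (for `Φ_i = Λ^{n_i}`: the source's `I_Λ^n`).
[cite: MellitVlasenko2016, §3 (definition of `I_Λ^n`)] -/
def Ipoly (p : ℕ) (Φ : ℕ → LaurentPoly R d) (L : ℕ) : LaurentPoly R d := cutSum p Φ L L

/-- Every `j ≥ L` is (vacuously) a cut. [cite: MellitVlasenko2016, §3 Definition (indecomposable tuples)] -/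
theorem isCut_of_le {L : ℕ} (t : Fin L → ℕ) {j : ℕ} (hj : L ≤ j) : IsCut L t j :=
  fun i hi => absurd (hi.trans_lt i.isLt) (not_lt.2 hj)

/-- Every tuple has exactly one first cut in `[1, L]` (`L ≥ 1`): existence.
[cite: MellitVlasenko2016, Prop. 3 (proof: unique factorisation)] -/
theorem exists_firstCut {L : ℕ} (hL : 1 ≤ L) (t : Fin L → ℕ) : ∃ j ∈ Icc 1 L, FirstCut L t j := by
  classical
  have hex : ∃ j, 1 ≤ j ∧ IsCut L t j := ⟨L, hL, isCut_of_le t le_rfl⟩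
  refine ⟨Nat.find hex, ?_, (Nat.find_spec hex).1, (Nat.find_spec hex).2, fun j' hj' hj1 hc => ?_⟩
  · rw [mem_Icc]
    exact ⟨(Nat.find_spec hex).1, Nat.find_min' hex ⟨hL, isCut_of_le t le_rfl⟩⟩
  · exact Nat.find_min hex hj' ⟨hj1, hc⟩

/-- Every tuple has exactly one first cut: uniqueness. [cite: MellitVlasenko2016, Prop. 3 (proof: unique
factorisation)] -/
theorem firstCut_unique {L : ℕ} {t : Fin L → ℕ} {j j' : ℕ} (hj : FirstCut L t j) (hj' : FirstCut L t j') :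
    j = j' := by
  by_contra hne
  rcases lt_or_gt_of_ne hne with h | h
  · exact hj'.2.2 j h hj.1 hj.2.1
  · exact hj.2.2 j' h hj'.1 hj'.2.1

/-- Grouping the tuples by their first cut: `Π_i Φ_i^{p^i} = Σ_{j=1}^{L} cutSum j`.
[cite: MellitVlasenko2016, Prop. 3 (i)] -/
theorem bigPow_eq_sum_cutSum (p : ℕ) (Φ : ℕ → LaurentPoly R d) {L : ℕ} (hL : 1 ≤ L) :
    bigPow p Φ L = ∑ j ∈ Icc 1 L, cutSum p Φ L j := by
  rw [bigPow_eq_sum_gterm]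
  unfold cutSum
  simp_rw [Finset.sum_filter]
  rw [Finset.sum_comm]
  refine Finset.sum_congr rfl fun t _ => ?_
  obtain ⟨j₀, hj₀, hfc⟩ := exists_firstCut hL t
  rw [Finset.sum_eq_single_of_mem j₀ hj₀ fun j _ hne => if_neg fun h => hne (firstCut_unique h hfc),
    if_pos hfc]

/-! ### The snoc recurrence in the length `L` -/

/-- Sums over `tuples (L+1)` as iterated sums (split off the last entry).
[cite: MellitVlasenko2016, Prop. 3 (proof)] -/
theorem sum_tuples_succ {M : Type*} [AddCommMonoid M] (L : ℕ) (F : (Fin (L + 1) → ℕ) → M) :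
    ∑ t ∈ tuples (L + 1), F t =
      ∑ t ∈ tuples L, ∑ a ∈ range (L + 1), F (Fin.snoc (α := fun _ => ℕ) t a) := by
  rw [show (∑ t ∈ tuples L, ∑ a ∈ range (L + 1), F (Fin.snoc (α := fun _ => ℕ) t a)) =
      ∑ ta ∈ tuples L ×ˢ range (L + 1), F (Fin.snoc (α := fun _ => ℕ) ta.1 ta.2) from
    (Finset.sum_product' _ _ _).symm]
  refine Finset.sum_bij' (fun t _ => (Fin.init t, t (Fin.last L)))
    (fun ta _ => Fin.snoc (α := fun _ => ℕ) ta.1 ta.2) ?_ ?_ ?_ ?_ ?_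
  · intro t ht
    rw [mem_tuples] at ht
    simp only [Finset.mem_product, mem_tuples, Finset.mem_range, Nat.lt_succ_iff]
    exact ⟨fun i => by simpa [Fin.init] using ht (Fin.castSucc i), by simpa using ht (Fin.last L)⟩
  · intro ta hta
    simp only [Finset.mem_product, mem_tuples, Finset.mem_range, Nat.lt_succ_iff] at hta
    rw [mem_tuples]
    intro i
    refine Fin.lastCases ?_ (fun i => ?_) i
    · simpa using hta.2
    · simpa using hta.1 i
  · intro t ht; exact Fin.snoc_init_self t
  · intro ta hta
    ext
    · simp [Fin.init_snoc]
    · simp [Fin.snoc_last]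
  · intro t ht
    simp [Fin.snoc_init_self]

/-- `R_{(t, a)} = R_t · R_{L−a}(Φ_L)(x^{p^a})` (split off the last position). [cite: MellitVlasenko2016, Prop. 3
(proof)] -/
theorem gterm_snoc (p : ℕ) (Φ : ℕ → LaurentPoly R d) (L : ℕ) (t : Fin L → ℕ) (a : ℕ) :
    gterm p Φ (L + 1) (Fin.snoc (α := fun _ => ℕ) t a) =
      gterm p Φ L t * frob (p ^ a) (ghost p (L - a) (Φ L)) := by
  unfold gterm
  rw [Fin.prod_univ_castSucc]
  simp only [Fin.snoc_castSucc, Fin.snoc_last, Fin.val_castSucc, Fin.val_last]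

/-- Cuts of an extended tuple `(t, a)`: `j ≤ L` is a cut iff it is a cut of `t` and `j ≤ a`.
[cite: MellitVlasenko2016, Prop. 3 (proof: concatenation of tuples)] -/
theorem isCut_snoc_iff {L : ℕ} (t : Fin L → ℕ) (a : ℕ) {j : ℕ} (hj : j ≤ L) :
    IsCut (L + 1) (Fin.snoc (α := fun _ => ℕ) t a) j ↔ IsCut L t j ∧ j ≤ a := by
  constructor
  · intro h
    refine ⟨fun i hi => ?_, ?_⟩
    · simpa using h (Fin.castSucc i) (by simpa using hi)
    · simpa using h (Fin.last L) (by simpa using hj)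
  · rintro ⟨h1, h2⟩ i
    refine Fin.lastCases ?_ (fun i => ?_) i
    · intro _; simpa using h2
    · intro hi; simpa using h1 i (by simpa using hi)

/-- First cuts of an extended tuple `(t, a)` below `L`. [cite: MellitVlasenko2016, Prop. 3 (proof: concatenation
of tuples)] -/
theorem firstCut_snoc_iff {L : ℕ} (t : Fin L → ℕ) (a : ℕ) {j : ℕ} (hj : j ≤ L) :
    FirstCut (L + 1) (Fin.snoc (α := fun _ => ℕ) t a) j ↔ FirstCut L t j ∧ j ≤ a := by
  constructor
  · rintro ⟨h1, hc, hmin⟩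
    rw [isCut_snoc_iff t a hj] at hc
    refine ⟨⟨h1, hc.1, fun j' hj' h1' hc' => hmin j' hj' h1' ?_⟩, hc.2⟩
    rw [isCut_snoc_iff t a (by omega)]
    exact ⟨hc', by omega⟩
  · rintro ⟨⟨h1, hc, hmin⟩, hja⟩
    refine ⟨h1, (isCut_snoc_iff t a hj).2 ⟨hc, hja⟩, fun j' hj' h1' hc' => hmin j' hj' h1' ?_⟩
    rw [isCut_snoc_iff t a (by omega)] at hc'
    exact hc'.1

/-- The recurrence `cutSum(Φ, L+1, j) = cutSum(Φ, L, j) · Σ_{a=j}^{L} R_{L−a}(Φ_L)(x^{p^a})` (`1 ≤ j ≤ L`).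
[cite: MellitVlasenko2016, Prop. 3 (i) (proof)] -/
theorem cutSum_succ (p : ℕ) (Φ : ℕ → LaurentPoly R d) {L j : ℕ} (hj : j ≤ L) :
    cutSum p Φ (L + 1) j =
      cutSum p Φ L j * ∑ a ∈ Icc j L, frob (p ^ a) (ghost p (L - a) (Φ L)) := by
  unfold cutSum
  rw [Finset.sum_filter, sum_tuples_succ, Finset.sum_filter, Finset.sum_mul]
  refine Finset.sum_congr rfl fun t _ => ?_
  by_cases hfc : FirstCut L t j
  · rw [if_pos hfc, Finset.mul_sum]
    have hIcc : Icc j L = (range (L + 1)).filter (fun a => j ≤ a) := by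
      ext a; simp only [mem_Icc, Finset.mem_filter, Finset.mem_range, Nat.lt_succ_iff]; tauto
    rw [hIcc, Finset.sum_filter]
    refine Finset.sum_congr rfl fun a _ => ?_
    by_cases hja : j ≤ a
    · rw [if_pos ((firstCut_snoc_iff t a hj).2 ⟨hfc, hja⟩), if_pos hja, gterm_snoc]
    · rw [if_neg (fun h => hja ((firstCut_snoc_iff t a hj).1 h).2), if_neg hja]
  · rw [if_neg hfc, zero_mul]
    refine Finset.sum_eq_zero fun a _ => ?_
    rw [if_neg (fun h => hfc ((firstCut_snoc_iff t a hj).1 h).1)]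

/-- `Π_{i<L+1} Φ_i^{p^i} = (Π_{i<L} Φ_i^{p^i}) · Φ_L^{p^L}`. [cite: MellitVlasenko2016, §2] -/
theorem bigPow_succ (p : ℕ) (Φ : ℕ → LaurentPoly R d) (L : ℕ) :
    bigPow p Φ (L + 1) = bigPow p Φ L * Φ L ^ p ^ L := by
  unfold bigPow
  rw [Fin.prod_univ_castSucc]
  simp

/-- The empty product. [cite: MellitVlasenko2016, §2] -/
@[simp] theorem bigPow_zero (p : ℕ) (Φ : ℕ → LaurentPoly R d) : bigPow p Φ 0 = 1 := by
  simp [bigPow]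

/-- **First-cut factorisation:** `cutSum(Φ, L, j) = I(Φ_0, …, Φ_{j−1}) · (Π_{i<L−j} Φ_{j+i}^{p^i})(x^{p^j})` for
`j ≤ L` — the summand `R_m` of a tuple with first cut `j` is the product of an indecomposable part on `[0, j)`
and an arbitrary part on `[j, L)` in the variables `x^{p^j}`. [cite: MellitVlasenko2016, Prop. 3 (i) (proof)] -/
theorem cutSum_eq (p : ℕ) (Φ : ℕ → LaurentPoly R d) {j L : ℕ} (hL : j ≤ L) :
    cutSum p Φ L j = Ipoly p Φ j * frob (p ^ j) (bigPow p (fun i => Φ (j + i)) (L - j)) := by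
  induction L, hL using Nat.le_induction with
  | base => simp [Ipoly]
  | succ L hL ih =>
    have hb : bigPow p (fun i => Φ (j + i)) (L - j + 1) =
        bigPow p (fun i => Φ (j + i)) (L - j) * Φ L ^ p ^ (L - j) := by
      rw [bigPow_succ, Nat.add_sub_cancel' hL]
    rw [cutSum_succ p Φ hL, ih, show L + 1 - j = L - j + 1 by omega, hb, map_mul, mul_assoc, map_pow,
      pow_prime_pow_eq_sum_ghost p (frob (p ^ j) (Φ L)) (L - j)]
    congr 2
    have hI : Icc j L = Ico j (L + 1) := by
      ext a; simp only [mem_Icc, mem_Ico]; constructor <;> rintro ⟨h1, h2⟩ <;> exact ⟨h1, by omega⟩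
    rw [hI, Finset.sum_Ico_eq_sum_range, show L + 1 - j = L - j + 1 by omega]
    refine Finset.sum_congr rfl fun u _ => ?_
    rw [show L - (j + u) = L - j - u by omega, ghost_frob, frob_frob, pow_add, mul_comm]

/-- **Proposition 3 (i), first-cut form:** `Π_{i<L} Φ_i^{p^i} = Σ_{j=1}^{L} I(Φ_0, …, Φ_{j−1}) ·
(Π_{i<L−j} Φ_{j+i}^{p^i})(x^{p^j})` (`L ≥ 1`). [cite: MellitVlasenko2016, Prop. 3 (i)] -/
theorem bigPow_decomp (p : ℕ) (Φ : ℕ → LaurentPoly R d) {L : ℕ} (hL : 1 ≤ L) :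
    bigPow p Φ L = ∑ j ∈ Icc 1 L, Ipoly p Φ j * frob (p ^ j) (bigPow p (fun i => Φ (j + i)) (L - j)) := by
  rw [bigPow_eq_sum_cutSum p Φ hL]
  refine Finset.sum_congr rfl fun j hj => ?_
  rw [mem_Icc] at hj
  exact cutSum_eq p Φ hj.2

/-! ### Proposition 2 and Proposition 3 (ii): the weight of an indecomposable tuple -/

/-- `p^{|m|} ∣ R_m`, `|m| = Σ_i m_i = Σ_i (i − t_i)`. [cite: MellitVlasenko2016, §2 ("`R^n_{m,Λ} ≡ 0 mod p^{|m|}`")] -/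
theorem gterm_dvd {p : ℕ} (hp : p.Prime) (hR : ∀ a : R, (p : R) ∣ a ^ p - a) (Φ : ℕ → LaurentPoly R d)
    (L : ℕ) (t : Fin L → ℕ) :
    (p : LaurentPoly R d) ^ (∑ i : Fin L, (i.val - t i)) ∣ gterm p Φ L t := by
  unfold gterm
  rw [← Finset.prod_pow_eq_pow_sum]
  refine Finset.prod_dvd_prod_of_dvd _ _ fun i _ => ?_
  have h := map_dvd (frob (R := R) (d := d) (p ^ t i)) (ghost_dvd hp hR (i.val - t i) (Φ i))
  rwa [map_pow, map_natCast] at h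

/-- **Proposition 2** (covering argument): if `j` is the first cut of `t` then `j − 1 ≤ Σ_i (i − t_i)` — each
`j' ∈ [1, j)` is not a cut, so some `i ≥ j'` has `t_i < j' ≤ i`, and position `i` accounts for at most `i − t_i`
such `j'`. [cite: MellitVlasenko2016, Prop. 2] -/
theorem sub_one_le_weight_of_firstCut {L : ℕ} {t : Fin L → ℕ} {j : ℕ} (hfc : FirstCut L t j) :
    j - 1 ≤ ∑ i : Fin L, (i.val - t i) := by
  classical
  have hcover : Ico 1 j ⊆ (Finset.univ : Finset (Fin L)).biUnion fun i => Ioc (t i) i.val := by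
    intro j' hj'
    rw [mem_Ico] at hj'
    have hnc := hfc.2.2 j' hj'.2 hj'.1
    simp only [IsCut, not_forall, not_le, exists_prop] at hnc
    obtain ⟨i, hi, hti⟩ := hnc
    exact Finset.mem_biUnion.2 ⟨i, Finset.mem_univ _, by rw [mem_Ioc]; exact ⟨hti, hi⟩⟩
  calc j - 1 = (Ico 1 j).card := by simp
    _ ≤ ((Finset.univ : Finset (Fin L)).biUnion fun i => Ioc (t i) i.val).card := Finset.card_le_card hcover
    _ ≤ ∑ i : Fin L, (Ioc (t i) i.val).card := Finset.card_biUnion_le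
    _ = ∑ i : Fin L, (i.val - t i) := by simp

/-- **Proposition 3 (ii):** `I(Φ_0, …, Φ_{L−1}) ≡ 0 mod p^{L−1}`. [cite: MellitVlasenko2016, Prop. 3 (ii)] -/
theorem Ipoly_dvd {p : ℕ} (hp : p.Prime) (hR : ∀ a : R, (p : R) ∣ a ^ p - a) (Φ : ℕ → LaurentPoly R d)
    (L : ℕ) : (p : LaurentPoly R d) ^ (L - 1) ∣ Ipoly p Φ L := by
  unfold Ipoly cutSum
  refine Finset.dvd_sum fun t ht => ?_
  rw [Finset.mem_filter] at ht
  exact (pow_dvd_pow _ (sub_one_le_weight_of_firstCut ht.2)).trans (gterm_dvd hp hR Φ L t)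

/-- An indecomposable product whose last factor is `Φ_{L−1} = 1` vanishes (`L ≥ 2`): position `L − 1` is not a
cut, so the factor there is `R_s(1) = 0` with `s ≥ 1`. [cite: MellitVlasenko2016, Prop. 3 (proof: "contains
`R_s(Λ^0) = R_s(1) = 0` for `s > 0`")] -/
theorem Ipoly_eq_zero_of_last {p : ℕ} (Φ : ℕ → LaurentPoly R d) {L : ℕ} (hL : 2 ≤ L) (h1 : Φ (L - 1) = 1) :
    Ipoly p Φ L = 0 := by
  unfold Ipoly cutSum
  refine Finset.sum_eq_zero fun t ht => ?_
  rw [Finset.mem_filter] at ht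
  have hnc := ht.2.2.2 (L - 1) (by omega) (by omega)
  simp only [IsCut, not_forall, not_le, exists_prop] at hnc
  obtain ⟨i, hi, hti⟩ := hnc
  have hiL : i.val = L - 1 := by have := i.isLt; omega
  unfold gterm
  refine Finset.prod_eq_zero (Finset.mem_univ i) ?_
  obtain ⟨s, hs⟩ : ∃ s, i.val - t i = s + 1 := ⟨i.val - t i - 1, by omega⟩
  rw [hs, show (Φ i : LaurentPoly R d) = 1 by rw [hiL, h1], ghost_succ_one, map_zero]

/-- `I` depends only on `Φ_0, …, Φ_{L−1}`. [cite: MellitVlasenko2016, §3 (definition of `I_Λ^n`)] -/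
theorem Ipoly_congr (p : ℕ) {Φ Ψ : ℕ → LaurentPoly R d} {L : ℕ} (h : ∀ i < L, Φ i = Ψ i) :
    Ipoly p Φ L = Ipoly p Ψ L := by
  unfold Ipoly cutSum gterm
  refine Finset.sum_congr rfl fun t _ => Finset.prod_congr rfl fun i _ => ?_
  rw [h i.val i.isLt]

/-! ## Proposition 1 (iii) / 3 (iii): supports inside dilates of the Newton polytope -/

/-- `SuppIn C Φ a`: every exponent of `Φ` lies in the dilate `a · C` (used with `C = Newt(Λ)`; this is how we
write "`Newt(Φ) ⊂ a Newt(Λ)`"). [cite: MellitVlasenko2016, Prop. 1 (iii)] -/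
def SuppIn (C : Set (Fin d → ℝ)) (Φ : LaurentPoly R d) (a : ℝ) : Prop :=
  ∀ u ∈ Φ.coeff.support, latticeEmb d u ∈ a • C

section SuppIn

variable {C : Set (Fin d → ℝ)}

/-- `0 ∈ a · C` when `0 ∈ C`. [folklore] -/
private theorem zero_mem_smul_of_zero_mem (h0 : (0 : Fin d → ℝ) ∈ C) (a : ℝ) : (0 : Fin d → ℝ) ∈ a • C :=
  ⟨0, h0, smul_zero a⟩

/-- Dilates of a convex set containing `0` increase. [folklore] -/
private theorem smul_set_mono_of_zero_mem (hC : Convex ℝ C) (h0 : (0 : Fin d → ℝ) ∈ C) {a b : ℝ}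
    (ha : 0 ≤ a) (hab : a ≤ b) : a • C ⊆ b • C := by
  rintro _ ⟨c, hc, rfl⟩
  rcases eq_or_lt_of_le (ha.trans hab) with hb | hb
  · have : a = 0 := le_antisymm (hb ▸ hab) ha
    subst this
    simp only [zero_smul]
    exact zero_mem_smul_of_zero_mem h0 b
  · refine ⟨(a / b) • c, hC.smul_mem_of_zero_mem h0 hc ⟨div_nonneg ha hb.le, ?_⟩, ?_⟩
    · exact div_le_one_of_le₀ hab hb.le
    · show b • (a / b) • c = a • c
      rw [smul_smul, mul_div_cancel₀ _ hb.ne']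

/-- `Newt(Φ) ⊂ a C ⊂ b C` for `0 ≤ a ≤ b` (`C` convex, `0 ∈ C`). [cite: MellitVlasenko2016, Prop. 1 (iii)
(proof)] -/
theorem SuppIn.mono (hC : Convex ℝ C) (h0 : (0 : Fin d → ℝ) ∈ C) {Φ : LaurentPoly R d} {a b : ℝ}
    (h : SuppIn C Φ a) (ha : 0 ≤ a) (hab : a ≤ b) : SuppIn C Φ b :=
  fun u hu => smul_set_mono_of_zero_mem hC h0 ha hab (h u hu)

/-- `Newt(0) = ∅`. [cite: MellitVlasenko2016, Prop. 1 (iii) (proof)] -/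
theorem suppIn_zero (a : ℝ) : SuppIn C (0 : LaurentPoly R d) a := fun u hu => by simp at hu

/-- `supp(Φ + Ψ) ⊂ supp Φ ∪ supp Ψ`. [cite: MellitVlasenko2016, Prop. 1 (iii) (proof)] -/
theorem SuppIn.add {Φ Ψ : LaurentPoly R d} {a : ℝ} (hΦ : SuppIn C Φ a) (hΨ : SuppIn C Ψ a) :
    SuppIn C (Φ + Ψ) a := by
  intro u hu
  rw [AddMonoidAlgebra.coeff_add] at hu
  rcases Finset.mem_union.1 (Finsupp.support_add hu) with h | h
  · exact hΦ u h
  · exact hΨ u h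

/-- `supp(−Φ) = supp Φ`. [cite: MellitVlasenko2016, Prop. 1 (iii) (proof)] -/
theorem SuppIn.neg {Φ : LaurentPoly R d} {a : ℝ} (hΦ : SuppIn C Φ a) : SuppIn C (-Φ) a := by
  intro u hu
  rw [AddMonoidAlgebra.coeff_neg, Finsupp.support_neg] at hu
  exact hΦ u hu

/-- `supp(Φ − Ψ) ⊂ supp Φ ∪ supp Ψ`. [cite: MellitVlasenko2016, Prop. 1 (iii) (proof)] -/
theorem SuppIn.sub {Φ Ψ : LaurentPoly R d} {a : ℝ} (hΦ : SuppIn C Φ a) (hΨ : SuppIn C Ψ a) :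
    SuppIn C (Φ - Ψ) a := by
  rw [sub_eq_add_neg]; exact hΦ.add hΨ.neg

/-- Supports of finite sums. [cite: MellitVlasenko2016, Prop. 1 (iii) (proof)] -/
theorem SuppIn.sum {ι : Type*} {s : Finset ι} {f : ι → LaurentPoly R d} {a : ℝ}
    (h : ∀ i ∈ s, SuppIn C (f i) a) : SuppIn C (∑ i ∈ s, f i) a := by
  classical
  induction s using Finset.induction_on with
  | empty => simpa using suppIn_zero a
  | insert i s hi ih =>
    rw [Finset.sum_insert hi]
    exact (h i (Finset.mem_insert_self _ _)).add (ih fun k hk => h k (Finset.mem_insert_of_mem hk))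

/-- `supp(ΦΨ) ⊂ supp Φ + supp Ψ`, hence `Newt(ΦΨ) ⊂ Newt Φ + Newt Ψ` and dilates add (convexity).
[cite: MellitVlasenko2016, Prop. 1 (iii) (proof: "`Newt(Φ^m) ⊂ m Newt(Φ)`")] -/
theorem SuppIn.mul (hC : Convex ℝ C) {Φ Ψ : LaurentPoly R d} {a b : ℝ} (hΦ : SuppIn C Φ a)
    (hΨ : SuppIn C Ψ b) (ha : 0 ≤ a) (hb : 0 ≤ b) : SuppIn C (Φ * Ψ) (a + b) := by
  classical
  intro u hu
  have := AddMonoidAlgebra.support_coeff_mul_subset Φ Ψ hu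
  rw [Finset.mem_add] at this
  obtain ⟨u1, hu1, u2, hu2, rfl⟩ := this
  rw [map_add, hC.add_smul ha hb]
  exact Set.add_mem_add (hΦ u1 hu1) (hΨ u2 hu2)

/-- `supp(1) = {0} ⊂ a C` (`0 ∈ C`). [cite: MellitVlasenko2016, Prop. 1 (iii) (proof)] -/
theorem suppIn_one (h0 : (0 : Fin d → ℝ) ∈ C) (a : ℝ) : SuppIn C (1 : LaurentPoly R d) a := by
  intro u hu
  rw [AddMonoidAlgebra.one_def, AddMonoidAlgebra.coeff_single] at hu
  have := Finsupp.support_single_subset hu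
  rw [Finset.mem_singleton] at this
  rw [this, map_zero]
  exact zero_mem_smul_of_zero_mem h0 a

/-- `Newt(Φ^n) ⊂ n Newt(Φ)`. [cite: MellitVlasenko2016, Prop. 1 (iii) (proof: "`Newt(Φ(x)^m) ⊂ m Newt(Φ(x))`")] -/
theorem SuppIn.pow (hC : Convex ℝ C) (h0 : (0 : Fin d → ℝ) ∈ C) {Φ : LaurentPoly R d} {a : ℝ}
    (hΦ : SuppIn C Φ a) (ha : 0 ≤ a) (n : ℕ) : SuppIn C (Φ ^ n) (n * a) := by
  induction n with
  | zero => simpa using suppIn_one h0 (0 : ℝ)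
  | succ n ih =>
    rw [pow_succ, Nat.cast_succ, add_mul, one_mul]
    exact ih.mul hC hΦ (by positivity) ha

/-- Newton polytopes of finite products add. [cite: MellitVlasenko2016, Prop. 1 (iii) (proof)] -/
theorem SuppIn.prod (hC : Convex ℝ C) (h0 : (0 : Fin d → ℝ) ∈ C) {ι : Type*} {s : Finset ι}
    {f : ι → LaurentPoly R d} {a : ι → ℝ} (h : ∀ i ∈ s, SuppIn C (f i) (a i)) (ha : ∀ i ∈ s, 0 ≤ a i) :
    SuppIn C (∏ i ∈ s, f i) (∑ i ∈ s, a i) := by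
  classical
  induction s using Finset.induction_on with
  | empty => simpa using suppIn_one h0 (0 : ℝ)
  | insert i s hi ih =>
    rw [Finset.prod_insert hi, Finset.sum_insert hi]
    exact (h i (Finset.mem_insert_self _ _)).mul hC
      (ih (fun k hk => h k (Finset.mem_insert_of_mem hk)) fun k hk => ha k (Finset.mem_insert_of_mem hk))
      (ha i (Finset.mem_insert_self _ _)) (Finset.sum_nonneg fun k hk => ha k (Finset.mem_insert_of_mem hk))

/-- `Newt(Φ(x^m)) = m Newt(Φ)`. [cite: MellitVlasenko2016, Prop. 1 (iii) (proof: "`Φ(x^m) ⊂ m Newt(Φ)`")] -/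
theorem SuppIn.frob {Φ : LaurentPoly R d} {a : ℝ} (hΦ : SuppIn C Φ a) (m : ℕ) :
    SuppIn C (frob m Φ) (m * a) := by
  intro v hv
  obtain ⟨u, hu, rfl⟩ := mem_support_frob hv
  rw [map_nsmul, ← Nat.cast_smul_eq_nsmul ℝ, ← smul_smul]
  exact Set.smul_mem_smul_set (hΦ u hu)

/-- **Proposition 1 (iii):** `Newt(R_s(Φ)) ⊂ p^s Newt(Φ)`. [cite: MellitVlasenko2016, Prop. 1 (iii)] -/
theorem SuppIn.ghost (hC : Convex ℝ C) (h0 : (0 : Fin d → ℝ) ∈ C) {Φ : LaurentPoly R d} {a : ℝ}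
    (hΦ : SuppIn C Φ a) (ha : 0 ≤ a) (p s : ℕ) : SuppIn C (ghost p s Φ) ((p : ℝ) ^ s * a) := by
  cases s with
  | zero => simpa using hΦ
  | succ s =>
    rw [ghost_succ]
    refine SuppIn.sub ?_ ?_
    · have := hΦ.pow hC h0 ha (p ^ (s + 1))
      simpa using this
    · have := (hΦ.pow hC h0 ha (p ^ s)).frob p
      simpa [pow_succ, mul_comm, mul_assoc, mul_left_comm] using this

/-- `Newt(R_m) ⊂ (Σ_i a_i p^i) Newt(Λ)` when `Newt(Φ_i) ⊂ a_i Newt(Λ)`.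
[cite: MellitVlasenko2016, §2 ("`Newt(R^n_{m,Λ}) ⊂ n Newt(Λ)`")] -/
theorem suppIn_gterm (hC : Convex ℝ C) (h0 : (0 : Fin d → ℝ) ∈ C) (p : ℕ) {Φ : ℕ → LaurentPoly R d}
    {a : ℕ → ℝ} (hΦ : ∀ i, SuppIn C (Φ i) (a i)) (ha : ∀ i, 0 ≤ a i) {L : ℕ} {t : Fin L → ℕ}
    (ht : t ∈ tuples L) : SuppIn C (gterm p Φ L t) (∑ i : Fin L, (p : ℝ) ^ i.val * a i) := by
  unfold gterm
  refine SuppIn.prod hC h0 (fun i _ => ?_) fun i _ => mul_nonneg (by positivity) (ha i)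
  rw [mem_tuples] at ht
  have h := ((hΦ i).ghost hC h0 (ha i) p (i.val - t i)).frob (p ^ t i)
  have : ((p ^ t i : ℕ) : ℝ) * ((p : ℝ) ^ (i.val - t i) * a i) = (p : ℝ) ^ i.val * a i := by
    rw [Nat.cast_pow, ← mul_assoc, ← pow_add, Nat.add_sub_cancel' (ht i)]
  rwa [this] at h

/-- **Proposition 3 (iii):** `Newt(I) ⊂ (Σ_i a_i p^i) Newt(Λ)`. [cite: MellitVlasenko2016, Prop. 3 (iii)] -/
theorem suppIn_Ipoly (hC : Convex ℝ C) (h0 : (0 : Fin d → ℝ) ∈ C) (p : ℕ) {Φ : ℕ → LaurentPoly R d}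
    {a : ℕ → ℝ} (hΦ : ∀ i, SuppIn C (Φ i) (a i)) (ha : ∀ i, 0 ≤ a i) (L : ℕ) :
    SuppIn C (Ipoly p Φ L) (∑ i : Fin L, (p : ℝ) ^ i.val * a i) := by
  unfold Ipoly cutSum
  exact SuppIn.sum fun t ht => suppIn_gterm hC h0 p hΦ ha (Finset.mem_filter.1 ht).1

end SuppIn

/-! ## §4. The case of one interior point -/

/-- The lattice `q ℤ^d` meets `n C` only in `0` when `n < q`, `0 ∈ interior C` and `0` is the only lattice
point of the interior of the convex set `C` ("since `Newt(I) ⊂ n Newt(Λ)` and `n < p^ℓ` we see that `N(I)` does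
not contain points of the lattice `p^ℓ ℤ^d` other than `0`"). [cite: MellitVlasenko2016, Prop. 4 (proof)] -/
theorem eq_zero_of_smul_mem_smul {C : Set (Fin d → ℝ)} (hC : Convex ℝ C)
    (hint : (0 : Fin d → ℝ) ∈ interior C) (hlat : ∀ u : Fin d → ℤ, latticeEmb d u ∈ interior C → u = 0)
    {n : ℝ} {q : ℕ} (hn : 0 ≤ n) (hnq : n < q) {v : Fin d → ℤ} (hv : latticeEmb d (q • v) ∈ n • C) : v = 0 := by
  have hq : (0 : ℝ) < q := hn.trans_lt hnq
  obtain ⟨c, hc, hcv⟩ := hv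
  change n • c = latticeEmb d (q • v) at hcv
  apply hlat
  have hemb : latticeEmb d v = (n / q) • c := by
    rw [map_nsmul, ← Nat.cast_smul_eq_nsmul ℝ] at hcv
    rw [div_eq_inv_mul, mul_smul, hcv, smul_smul, inv_mul_cancel₀ hq.ne', one_smul]
  have := hC.combo_interior_self_mem_interior hint hc (a := 1 - n / q) (b := n / q)
    (by rw [sub_pos, div_lt_one hq]; exact hnq) (by positivity) (by ring)
  rwa [smul_zero, zero_add, ← hemb] at this

/-- **Proposition 4:** `[Φ(x) · Ψ(x^q)]_0 = [Φ]_0 [Ψ]_0` when `Newt(Φ) ⊂ n Newt(Λ)`, `n < q`, and `0` is the only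
interior lattice point of `Newt(Λ)`. [cite: MellitVlasenko2016, Prop. 4] -/
theorem constTerm_mul_frob {C : Set (Fin d → ℝ)} (hC : Convex ℝ C) (hint : (0 : Fin d → ℝ) ∈ interior C)
    (hlat : ∀ u : Fin d → ℤ, latticeEmb d u ∈ interior C → u = 0) {Φ Ψ : LaurentPoly R d} {n : ℝ} {q : ℕ}
    (hΦ : SuppIn C Φ n) (hn : 0 ≤ n) (hnq : n < q) :
    constTerm (Φ * frob q Ψ) = constTerm Φ * constTerm Ψ := by
  classical
  have hq0 : q ≠ 0 := by rintro rfl; exact absurd hnq (not_lt.2 (by simpa using hn))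
  -- the only pair `(u₁, u₂) ∈ supp Φ × supp Ψ(x^q)` with `u₁ + u₂ = 0` is `(0, 0)`
  have key : ∀ u1 ∈ Φ.coeff.support, ∀ u2 ∈ (frob q Ψ).coeff.support, u1 + u2 = 0 → u1 = 0 ∧ u2 = 0 := by
    intro u1 hu1 u2 hu2 h12
    obtain ⟨v, hv, rfl⟩ := mem_support_frob hu2
    have hveq : u1 = q • (-v) := by rw [smul_neg]; exact eq_neg_of_add_eq_zero_left h12
    have h1 := hΦ u1 hu1
    rw [hveq] at h1
    have hv0 : v = 0 := neg_eq_zero.1 (eq_zero_of_smul_mem_smul hC hint hlat hn hnq h1)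
    subst hv0
    simpa using h12
  unfold constTerm
  rw [AddMonoidAlgebra.coeff_mul]
  simp only [Finsupp.sum]
  calc ∑ u1 ∈ Φ.coeff.support, ∑ u2 ∈ (frob q Ψ).coeff.support,
        (if u1 + u2 = 0 then Φ.coeff u1 * (frob q Ψ).coeff u2 else 0)
      = ∑ u1 ∈ Φ.coeff.support, ∑ u2 ∈ (frob q Ψ).coeff.support,
          ((if u1 = 0 then Φ.coeff u1 else 0) * (if u2 = 0 then (frob q Ψ).coeff u2 else 0)) := by
        refine Finset.sum_congr rfl fun u1 hu1 => Finset.sum_congr rfl fun u2 hu2 => ?_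
        by_cases h12 : u1 + u2 = 0
        · obtain ⟨h1, h2⟩ := key u1 hu1 u2 hu2 h12
          simp [h1, h2]
        · rw [if_neg h12]
          by_cases h1 : u1 = 0
          · have h2 : u2 ≠ 0 := fun h2 => h12 (by rw [h1, h2, add_zero])
            rw [if_neg h2, mul_zero]
          · rw [if_neg h1, zero_mul]
    _ = (∑ u1 ∈ Φ.coeff.support, if u1 = 0 then Φ.coeff u1 else 0) *
          ∑ u2 ∈ (frob q Ψ).coeff.support, (if u2 = 0 then (frob q Ψ).coeff u2 else 0) := by
        rw [Finset.sum_mul_sum]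
    _ = Φ.coeff 0 * (frob q Ψ).coeff 0 := by
        congr 1
        · rw [Finset.sum_ite_eq']
          split_ifs with h
          · rfl
          · exact (by simpa using h : Φ.coeff 0 = 0).symm
        · rw [Finset.sum_ite_eq']
          split_ifs with h
          · rfl
          · exact (by simpa using h : (frob q Ψ).coeff 0 = 0).symm
    _ = Φ.coeff 0 * Ψ.coeff 0 := by
        have := constTerm_frob hq0 Ψ
        unfold constTerm at this
        rw [this]

/-! ## Lemma 1 (first-block form) and the Dwork congruence -/

section Assembly

variable {p : ℕ}

/-- The constant term is additive over finite sums. [cite: SamolVanstraten2015, §3 Notation 4] -/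
theorem constTerm_sum {ι : Type*} (s : Finset ι) (f : ι → LaurentPoly R d) :
    constTerm (∑ i ∈ s, f i) = ∑ i ∈ s, constTerm (f i) := by
  unfold constTerm
  rw [AddMonoidAlgebra.coeff_sum, Finsupp.finsetSum_apply]

/-- `p^m ∣ Φ` in `R[x^{±1}]` implies `p^m ∣ [Φ]_0` in `R`. [cite: MellitVlasenko2016, Lemma 1 (A2)] -/
theorem constTerm_dvd_of_dvd {m : ℕ} {Φ : LaurentPoly R d} (h : (p : LaurentPoly R d) ^ m ∣ Φ) :
    (p : R) ^ m ∣ constTerm Φ := by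
  obtain ⟨Ψ, rfl⟩ := h
  refine ⟨constTerm Ψ, ?_⟩
  unfold constTerm
  rw [show ((p : LaurentPoly R d)) ^ m = AddMonoidAlgebra.single 0 ((p : R) ^ m) by
    rw [AddMonoidAlgebra.natCast_def, AddMonoidAlgebra.single_pow, smul_zero],
    AddMonoidAlgebra.coeff_single_zero_mul]

/-- The digit powers `Φ_i = Λ^{n_i}`, `n_i = ⌊n/p^i⌋ mod p`. [cite: MellitVlasenko2016, §2
("`Λ^n = Λ^{n_0} (Λ^{n_1})^p ⋯ (Λ^{n_{ℓ(n)−1}})^{p^{ℓ(n)−1}}`")] -/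
def digitPow (p : ℕ) (Λ : LaurentPoly R d) (n : ℕ) : ℕ → LaurentPoly R d := fun i => Λ ^ (n / p ^ i % p)

/-- `I_Λ^n := Σ_{m ∈ S^{ind}_{ℓ(n)}} R^n_{m,Λ}`. [cite: MellitVlasenko2016, §3 (definition of `I_Λ^n`)] -/
def Ipow (p : ℕ) (Λ : LaurentPoly R d) (n : ℕ) : LaurentPoly R d := Ipoly p (digitPow p Λ n) (len p n)

/-- `c_n := [I_Λ^n]_0`, the sequence of Lemma 1. [cite: MellitVlasenko2016, Lemma 1 (proof: "Put
`c_n = [I_Λ^n]_0`")] -/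
def cseq (p : ℕ) (Λ : LaurentPoly R d) (n : ℕ) : R := constTerm (Ipow p Λ n)

/-- `Σ_{i<L} n_i p^i = n mod p^L`. [cite: MellitVlasenko2016, §1 (base-`p` expansion)] -/
theorem sum_digit_mul_pow (p n L : ℕ) : ∑ i ∈ range L, n / p ^ i % p * p ^ i = n % p ^ L := by
  induction L with
  | zero => simp [Nat.mod_one]
  | succ L ih => rw [Finset.sum_range_succ, ih, Nat.mod_pow_succ]; ring

/-- `Π_{i<L} (Λ^{n_i})^{p^i} = Λ^{n mod p^L}`. [cite: MellitVlasenko2016, §2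
("`Λ^n = Λ^{n_0} (Λ^{n_1})^p ⋯`")] -/
theorem bigPow_digitPow (p : ℕ) (Λ : LaurentPoly R d) (n L : ℕ) :
    bigPow p (digitPow p Λ n) L = Λ ^ (n % p ^ L) := by
  unfold bigPow digitPow
  simp_rw [← pow_mul]
  rw [Finset.prod_pow_eq_pow_sum, Fin.sum_univ_eq_sum_range (fun i => n / p ^ i % p * p ^ i) L,
    sum_digit_mul_pow]

/-- The digits of `⌊n/p^j⌋` are the digits of `n` shifted by `j`. [cite: MellitVlasenko2016, §1 (base-`p`
expansion)] -/
theorem digitPow_shift (p : ℕ) (Λ : LaurentPoly R d) (n j : ℕ) :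
    (fun i => digitPow p Λ n (j + i)) = digitPow p Λ (n / p ^ j) := by
  funext i
  simp only [digitPow, pow_add, Nat.div_div_eq_div_mul]

/-- The digits of `n mod p^j` below `j` are those of `n`. [cite: MellitVlasenko2016, §1 (base-`p` expansion)] -/
theorem digitPow_mod (Λ : LaurentPoly R d) (n : ℕ) {j i : ℕ} (hi : i < j) :
    digitPow p Λ (n % p ^ j) i = digitPow p Λ n i := by
  obtain ⟨m, rfl⟩ := Nat.exists_eq_add_of_lt hi
  simp only [digitPow]
  rw [show i + m + 1 = i + (m + 1) by omega, pow_add, Nat.mod_mul_right_div_self,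
    Nat.mod_mod_of_dvd _ (dvd_pow_self p (Nat.succ_ne_zero m))]

/-- `Newt(I_Λ^n) ⊂ n Newt(Λ)`. [cite: MellitVlasenko2016, Prop. 3 (iii)] -/
theorem suppIn_Ipow (hp : 1 < p) (Λ : LaurentPoly R d) (h0 : (0 : Fin d → ℝ) ∈ newtonPolytope Λ) (n : ℕ) :
    SuppIn (newtonPolytope Λ) (Ipow p Λ n) (n : ℝ) := by
  have hC : Convex ℝ (newtonPolytope Λ) := convex_convexHull ℝ _
  have hΛC : SuppIn (newtonPolytope Λ) Λ 1 := fun u hu => by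
    rw [one_smul]; exact subset_convexHull ℝ _ ⟨u, hu, rfl⟩
  have hΦ : ∀ i, SuppIn (newtonPolytope Λ) (digitPow p Λ n i) ((n / p ^ i % p : ℕ) : ℝ) := fun i => by
    have := hΛC.pow hC h0 zero_le_one (n / p ^ i % p)
    rwa [mul_one] at this
  have h := suppIn_Ipoly hC h0 p hΦ (fun i => Nat.cast_nonneg _) (len p n)
  have hsum : ∑ i : Fin (len p n), (p : ℝ) ^ i.val * ((n / p ^ i.val % p : ℕ) : ℝ) = n := by
    have := congrArg (fun k : ℕ => (k : ℝ)) (sum_digit_mul_pow p n (len p n))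
    rw [Nat.mod_eq_of_lt (lt_pow_len hp n)] at this
    rw [← this, Nat.cast_sum, ← Fin.sum_univ_eq_sum_range]
    refine Finset.sum_congr rfl fun i _ => ?_
    push_cast; ring
  rwa [hsum] at h

/-- **Lemma 1 (A2):** `c_n ≡ 0 mod p^{ℓ(n)−1}`. [cite: MellitVlasenko2016, Lemma 1 (A2)] -/
theorem cseq_dvd (hp : p.Prime) (hR : ∀ a : R, (p : R) ∣ a ^ p - a) (Λ : LaurentPoly R d) (k : ℕ) :
    (p : R) ^ (len p k - 1) ∣ cseq p Λ k :=
  constTerm_dvd_of_dvd (Ipoly_dvd hp hR (digitPow p Λ k) (len p k))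

/-- **Lemma 1 (A1) in first-block form / Corollary of §4:** for `Λ` whose Newton polytope has the origin as
its only interior lattice point, `b_n = Σ_{j=1}^{ℓ(n)} [block admissible] c_{n mod p^j} · b_{⌊n/p^j⌋}` (split off
the first block `n^{(1)} = n mod p^j` of each partition `n = n^{(1)} * ⋯ * n^{(r)}` in (A1)).
[cite: MellitVlasenko2016, Lemma 1 (A1) and §4 Corollary] -/
theorem ctPow_blockRecursion (hp : p.Prime) (Λ : LaurentPoly R d) (hΛ : OriginUniqueInteriorLatticePoint Λ)
    (n : ℕ) :
    ctPow Λ n = ∑ j ∈ Icc 1 (len p n),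
      if BlockValid p n j then cseq p Λ (n % p ^ j) * ctPow Λ (n / p ^ j) else 0 := by
  have hp1 := hp.one_lt
  have hC : Convex ℝ (newtonPolytope Λ) := convex_convexHull ℝ _
  have h0 : (0 : Fin d → ℝ) ∈ newtonPolytope Λ := interior_subset hΛ.1
  have hlen : 1 ≤ len p n := by simp [len]
  have e0 : Λ ^ n = bigPow p (digitPow p Λ n) (len p n) := by
    rw [bigPow_digitPow, Nat.mod_eq_of_lt (lt_pow_len hp1 n)]
  unfold ctPow
  rw [e0, bigPow_decomp p _ hlen, constTerm_sum]
  refine Finset.sum_congr rfl fun j hj => ?_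
  rw [mem_Icc] at hj
  -- the tail factor is `Λ^{⌊n/p^j⌋}` in the variables `x^{p^j}`
  have htail : bigPow p (fun i => digitPow p Λ n (j + i)) (len p n - j) = Λ ^ (n / p ^ j) := by
    rw [digitPow_shift, bigPow_digitPow, Nat.mod_eq_of_lt]
    apply Nat.div_lt_of_lt_mul
    rw [← pow_add, Nat.add_sub_cancel' hj.2]
    exact lt_pow_len hp1 n
  rw [htail]
  by_cases hV : BlockValid p n j
  · rw [if_pos hV]
    -- the head factor is `I_Λ^{n mod p^j}`
    have hhead : Ipoly p (digitPow p Λ n) j = Ipow p Λ (n % p ^ j) := by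
      unfold Ipow
      rw [len_mod_pow_of_blockValid hp1 hj.1 hV]
      exact Ipoly_congr p fun i hi => (digitPow_mod Λ n hi).symm
    rw [hhead]
    exact constTerm_mul_frob hC hΛ.1 hΛ.2 (suppIn_Ipow hp1 Λ h0 (n % p ^ j)) (Nat.cast_nonneg _)
      (by exact_mod_cast Nat.mod_lt n (pow_pos hp.pos j))
  · rw [if_neg hV]
    have hj2 : 2 ≤ j := by
      by_contra h; exact hV (Or.inl (by omega))
    have hdig : n / p ^ (j - 1) % p = 0 := by
      by_contra h; exact hV (Or.inr h)
    rw [Ipoly_eq_zero_of_last (digitPow p Λ n) hj2 (by simp [digitPow, hdig]), zero_mul]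
    rfl

/-- **The Dwork congruence (D3) = (dig2) for constant terms of powers**, over any commutative coefficient ring
with `p ∣ a^p − a`: if the Newton polytope of `Λ` has the origin as its only interior lattice point then for all
`s ≥ 1`, `n, m ≥ 0`: `p^s ∣ b_{n+mp^s} b_{⌊n/p⌋} − b_n b_{⌊n/p⌋+mp^{s−1}}`, `b_n = [Λ^n]_0`.
[cite: MellitVlasenko2016, Thm. 1 and §1 (dig2); SamolVanstraten2015, Thm. 6] -/
theorem dwork_congruence (hp : p.Prime) (hR : ∀ a : R, (p : R) ∣ a ^ p - a) (Λ : LaurentPoly R d)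
    (hΛ : OriginUniqueInteriorLatticePoint Λ) {s : ℕ} (hs : 1 ≤ s) (n m : ℕ) :
    (p : R) ^ s ∣ ctPow Λ (n + m * p ^ s) * ctPow Λ (n / p) - ctPow Λ n * ctPow Λ (n / p + m * p ^ (s - 1)) :=
  dwork_congruence_of_blockRecursion hp.one_lt (b := ctPow Λ) (c := cseq p Λ)
    (ctPow_blockRecursion hp Λ hΛ) (cseq_dvd hp hR Λ) hs n m

end Assembly

/-- **Samol–van Straten 2015, Theorem 6, PROVED** (integer coefficients; `a^p ≡ a mod p` is Fermat's little
theorem). [cite: SamolVanstraten2015, Thm. 6] -/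
theorem samolVanStraten2015_theorem6_holds : samolVanStraten2015_theorem6 := by
  intro d Λ hΛ p hp s hs n m _hn
  have hR : ∀ a : ℤ, (p : ℤ) ∣ a ^ p - a := fun a => by
    haveI := Fact.mk hp
    rw [← ZMod.intCast_zmod_eq_zero_iff_dvd]
    push_cast
    rw [ZMod.pow_card, sub_self]
  exact (Int.modEq_iff_dvd.2 (dwork_congruence hp hR Λ hΛ hs n m)).symm

/-- The same over `ℤ_p` (the coefficient ring of [MellitVlasenko2016, Thm. 1]): the congruence (dig2) for
`Λ ∈ ℤ_p[x_1^{±1}, …, x_d^{±1}]`. [cite: MellitVlasenko2016, §1 (dig2)] -/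
theorem dwork_congruence_padicInt (p : ℕ) [Fact p.Prime] {d : ℕ} (Λ : LaurentPoly ℤ_[p] d)
    (hΛ : OriginUniqueInteriorLatticePoint Λ) {s : ℕ} (hs : 1 ≤ s) (n m : ℕ) :
    (p : ℤ_[p]) ^ s ∣
      ctPow Λ (n + m * p ^ s) * ctPow Λ (n / p) - ctPow Λ n * ctPow Λ (n / p + m * p ^ (s - 1)) := by
  refine dwork_congruence (Fact.out) (fun a => ?_) Λ hΛ hs n m
  rw [← Ideal.mem_span_singleton, ← PadicInt.maximalIdeal_eq_span_p, ← PadicInt.ker_toZMod, RingHom.mem_ker,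
    map_sub, map_pow, ZMod.pow_card, sub_self]

end Literature.NumberTheory.Congruences.DworkCongruences
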